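import Mathlib.RingTheory.AdicCompletion.Functoriality
import Mathlib.LinearAlgebra.FreeModule.PID
import Mathlib.Algebra.Module.Torsion.Free
import Literature.NumberTheory.EllipticCurves.TateModule
import HarnessLib

/-!
# Tate modules: freeness over `ℤ_p` from finiteness of `A[p]` (proofs for `TateModule.lean`)

Sibling proof file of `Literature.NumberTheory.EllipticCurves.TateModule` for the named facts
`WeierstrassCurve.module_free_tateModule` / `module_finite_tateModule` (Silverman, *AEC*,
Prop. III.7.1(a),(b): `T_p E` is free of finite rank over `ℤ_p` for *every* prime `p`, including
`p = char F`). Kept separate from `TateModule.lean` because of heavier imports (adic completions,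
modules over a PID), and from `TateModuleProofs.lean` (the rank-`2` statement III.7.1(a) for
`p ≠ char F` from the point count `#E[p^k] = p^{2k}`, III.6.4(b)) because the route here is
different and covers all `p`: only *finiteness* of `E(F̄)[p]` is used.

## Contents

* Generic part (namespace `Literature.NumberTheory.EllipticCurves.TateModule`, `A` any abelian group, `p` a prime):
  - `T_p A` is a torsion-free `ℤ_[p]`-module (`instIsTorsionFree`);
  - `T_p A` is `p`-adically separated (`instIsHausdorff`: an element of `p ^ k • T_p A` has
    vanishing components in degrees `≤ k`);
  - the kernel of the first projection `T_p A → A[p]` is `p • T_p A` (`p_smul_div`);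
  - **if `A[p]` is finite then `T_p A` is a finitely generated free `ℤ_[p]`-module**
    (`finite_of_finite_torsionBy`, `free_of_finite_torsionBy`). This is the algebra behind
    "Proposition III.7.1 follows immediately from Corollary III.6.4" in Silverman: lifts of the
    finitely many classes of `T_p A / p T_p A ↪ A[p]` generate `T_p A` because `ℤ_[p]` is
    `p`-adically complete and `T_p A` is `p`-adically separated (Mathlib's
    `surjective_of_mkQ_comp_surjective`, a form of Nakayama's lemma for complete rings), and a
    finitely generated torsion-free module over the PID `ℤ_[p]` is free.
* A general lemma `Literature.NumberTheory.EllipticCurves.isAdicComplete_pi`: a finite product of copies of an `I`-adically complete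
  ring is `I`-adically complete (via Mathlib's `AdicCompletion.piEquivOfFintype`).
* Elliptic-curve part (namespace `WeierstrassCurve`): the named facts
  `module_finite_tateModule W p` and `module_free_tateModule W p` of `TateModule.lean`
  (Silverman, *AEC*, Prop. III.7.1) are reduced to the single named fact
  `finite_torsionPoints W (AlgebraicClosure F)` of `GaloisAction.lean` (finiteness of `E(F̄)[n]`,
  Silverman, *AEC*, Cor. III.6.4): `module_free_tateModule_of_finite_torsionPoints`.

## What remains for `module_free_tateModule_holds`

Only `finite_torsionPoints` (Silverman III.6.4: `E(F̄)[n]` finite for `n ≠ 0`), whose printed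
proof rests on `deg [m] = m²` (dual isogenies, III.6.2) and `#ker φ = deg_s φ` (III.4.10), none of
which is in Mathlib; see the session NOTES for the planned route via division polynomials.

## References

* J. H. Silverman, *The Arithmetic of Elliptic Curves*, 2nd ed., GTM 106 (2009), III.§7,
  Prop. III.7.1 and Cor. III.6.4 (held PDF pp. 83 and 81–82). [SilvermanAEC2009]
* Stacks Project, Tag 031D (Nakayama's lemma for complete rings: generators mod `I` lift).
-/

noncomputable section

open scoped Classical
open scoped AddSubgroup

universe u

namespace Literature.NumberTheory.EllipticCurves

/-! ## Adic completeness of finite free modules -/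

section AdicPi

variable {R : Type*} [CommRing R] (I : Ideal R) (ι : Type*) [Finite ι]

/-- A finite product `ι → R` of copies of an `I`-adically complete ring `R` is `I`-adically
complete (as an `R`-module): adic completion commutes with finite products
(Mathlib `AdicCompletion.piEquivOfFintype`). [folklore] -/
theorem isAdicComplete_pi [IsAdicComplete I R] : IsAdicComplete I (ι → R) := by
  classical
  cases nonempty_fintype ι
  rw [← AdicCompletion.of_bijective_iff]
  have hcomp : (fun (x : ι → R) (i : ι) ↦ AdicCompletion.of I R (x i)) =
      (AdicCompletion.piEquivOfFintype I (fun _ : ι ↦ R)) ∘ (AdicCompletion.of I (ι → R)) := by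
    funext x i
    simp only [Function.comp_apply, AdicCompletion.piEquivOfFintype_apply]
    change _ = AdicCompletion.map I (LinearMap.proj i) (AdicCompletion.of I (ι → R) x)
    rw [AdicCompletion.map_of, LinearMap.proj_apply]
  have hb : Function.Bijective (fun (x : ι → R) (i : ι) ↦ AdicCompletion.of I R (x i)) := by
    refine ⟨fun x y hxy ↦ funext fun i ↦ AdicCompletion.of_injective I R (congr_fun hxy i),
      fun y ↦ ⟨fun i ↦ (AdicCompletion.of_surjective I R (y i)).choose, funext fun i ↦
        (AdicCompletion.of_surjective I R (y i)).choose_spec⟩⟩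
  rw [hcomp] at hb
  exact (LinearEquiv.bijective _).of_comp_iff' _ |>.mp hb

end AdicPi

/-! ## Generic Tate modules: torsion-freeness, separatedness, finiteness, freeness -/

namespace TateModule

variable {A : Type u} [AddCommGroup A] {p : ℕ}

/-- The first component of an element of `T_p A` is a `p`-torsion element of `A`. [folklore] -/
theorem proj_one_mem_torsionBy (a : TateModule A p) : proj p 1 a ∈ A[(p : ℕ)] := by
  simpa using proj_mem_torsionBy 1 a

/-- Iterating the compatibility `p • a_{n+1} = a_n`: `p ^ k • a_{k+n} = a_n` (the form with the
shift on the left, as needed for `div` below; cf. `pow_smul_proj_add` in `TateModuleProofs.lean`).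
Silverman, *AEC*, III.§7. [folklore] -/
theorem pow_smul_proj_self_add (k n : ℕ) (a : TateModule A p) :
    p ^ k • proj p (k + n) a = proj p n a := by
  induction k with
  | zero => simp
  | succ k ih =>
    rw [pow_succ, ← smul_smul, show k + 1 + n = (k + n) + 1 by ring, smul_proj_succ (k + n) a, ih]

/-- Division by `p` on the kernel of the first projection: if `a_1 = 0` then the shifted sequence
`(a_{n+1})_n` is again an element of `T_p A` (and `p •` it is `a`, see `p_smul_div`).
Silverman, *AEC*, III.§7. [folklore] -/
def div (a : TateModule A p) (h : proj p 1 a = 0) : TateModule A p :=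
  mk (fun n ↦ proj p (n + 1) a)
    (fun n ↦ by rw [pow_smul_proj_self_add n 1 a, h])
    (fun n ↦ smul_proj_succ (n + 1) a)

/-- Components of `div`: `(div a h)_n = a_{n+1}`. [folklore] -/
@[simp]
theorem proj_div (a : TateModule A p) (h : proj p 1 a = 0) (n : ℕ) :
    proj p n (div a h) = proj p (n + 1) a :=
  rfl

variable [Fact p.Prime]

/-- Components of the action of a natural number `k ∈ ℤ_[p]`: `((k : ℤ_[p]) • a)_n = k • a_n`
(the residue of `k` mod `p ^ n` acts on the `p ^ n`-torsion element `a_n` as `k` does). [folklore] -/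
@[simp]
theorem proj_natCast_smul (k : ℕ) (a : TateModule A p) (n : ℕ) :
    proj p n ((k : ℤ_[p]) • a) = k • proj p n a := by
  rw [proj_smul, map_natCast, ZMod.val_natCast,
    ← AddSubgroup.torsionBy.mod_self_nsmul' _ (proj_mem_torsionBy n a)]

/-- Components of the action of `p ^ k ∈ ℤ_[p]`: `((p : ℤ_[p]) ^ k • a)_n = p ^ k • a_n`. [folklore] -/
@[simp]
theorem proj_pow_smul (k : ℕ) (a : TateModule A p) (n : ℕ) :
    proj p n ((p : ℤ_[p]) ^ k • a) = p ^ k • proj p n a := by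
  rw [← Nat.cast_pow, proj_natCast_smul]

/-- `T_p A` has no `p`-power torsion: if `(p : ℤ_[p]) ^ k • a = 0` then `a = 0`
(`a_n = p ^ k • a_{k+n} = ((p ^ k) • a)_{k+n} = 0`). Silverman, *AEC*, III.§7. [folklore] -/
theorem eq_zero_of_pow_smul_eq_zero {k : ℕ} {a : TateModule A p}
    (h : (p : ℤ_[p]) ^ k • a = 0) : a = 0 := by
  ext n
  rw [← pow_smul_proj_self_add k n a, ← proj_pow_smul, h, map_zero, map_zero]

/-- The Tate module `T_p A` of any abelian group is a torsion-free `ℤ_[p]`-module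
(every non-zero `x ∈ ℤ_p` is a unit times a power of `p`). Silverman, *AEC*, III.§7. [folklore] -/
instance instIsTorsionFree : Module.IsTorsionFree ℤ_[p] (TateModule A p) := by
  refine Module.IsTorsionFree.of_smul_eq_zero fun r a h ↦ ?_
  by_cases hr : r = 0
  · exact Or.inl hr
  · right
    rw [PadicInt.unitCoeff_spec hr, mul_smul, IsUnit.smul_eq_zero (Units.isUnit _)] at h
    exact eq_zero_of_pow_smul_eq_zero h

/-- An element of `𝔪 ^ k • T_p A = p ^ k • T_p A` (`𝔪` the maximal ideal of `ℤ_[p]`) has vanishing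
components in all degrees `n ≤ k`. [folklore] -/
theorem proj_eq_zero_of_mem_pow_smul_top {k n : ℕ} (hn : n ≤ k) {a : TateModule A p}
    (ha : a ∈ (IsLocalRing.maximalIdeal ℤ_[p] ^ k • ⊤ : Submodule ℤ_[p] (TateModule A p))) :
    proj p n a = 0 := by
  rw [PadicInt.maximalIdeal_eq_span_p, Ideal.span_singleton_pow] at ha
  refine Submodule.smul_induction_on (p := fun b ↦ proj p n b = 0) ha (fun r hr b _ ↦ ?_)
    (fun x y hx hy ↦ ?_)
  · obtain ⟨c, rfl⟩ := Ideal.mem_span_singleton'.mp hr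
    obtain ⟨j, rfl⟩ := exists_add_of_le hn
    rw [mul_smul, proj_smul, proj_pow_smul, add_comm n j, pow_add, ← smul_smul, pow_smul_proj,
      smul_zero, smul_zero]
  · rw [map_add, hx, hy, add_zero]

/-- The Tate module `T_p A` of any abelian group is `p`-adically separated:
`⋂ₖ p ^ k • T_p A = 0`. Serre (1968), I.1.1; Silverman, *AEC*, III.§7. [folklore] -/
instance instIsHausdorff :
    IsHausdorff (IsLocalRing.maximalIdeal ℤ_[p]) (TateModule A p) := by
  refine ⟨fun a ha ↦ TateModule.ext fun n ↦ ?_⟩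
  rw [map_zero]
  exact proj_eq_zero_of_mem_pow_smul_top le_rfl (SModEq.zero.mp (ha n))

/-- `p • div a h = a`: an element of `T_p A` with vanishing first component is divisible by `p`,
i.e. `ker (T_p A → A[p]) = p • T_p A`. Silverman, *AEC*, III.§7. [folklore] -/
@[simp]
theorem p_smul_div (a : TateModule A p) (h : proj p 1 a = 0) : (p : ℤ_[p]) • div a h = a := by
  ext n
  rw [proj_natCast_smul, proj_div, smul_proj_succ]

/-- An element of `T_p A` with vanishing first component lies in `𝔪 • T_p A`. [folklore] -/
theorem mem_maximalIdeal_smul_top_of_proj_one_eq_zero {a : TateModule A p} (h : proj p 1 a = 0) :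
    a ∈ (IsLocalRing.maximalIdeal ℤ_[p] • ⊤ : Submodule ℤ_[p] (TateModule A p)) := by
  rw [← p_smul_div a h]
  refine Submodule.smul_mem_smul ?_ Submodule.mem_top
  rw [PadicInt.maximalIdeal_eq_span_p]
  exact Ideal.mem_span_singleton_self _

/-- **Finiteness of the Tate module.** If the `p`-torsion `A[p]` of an abelian group `A` is finite,
then `T_p A` is a finitely generated `ℤ_[p]`-module: lifts to `T_p A` of the (finitely many) values
of the first projection `T_p A → A[p]` generate, by Nakayama's lemma for the `p`-adically complete
ring `ℤ_p` and the `p`-adically separated module `T_p A` (`ker (T_p A → A[p]) = p T_p A`).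
This is the algebraic content of Silverman, *AEC*, Prop. III.7.1 (proof: "immediate from III.6.4").
[cite: SilvermanAEC2009, Prop. III.7.1 (proof)] -/
theorem finite_of_finite_torsionBy (hA : Finite (A[(p : ℕ)])) :
    Module.Finite ℤ_[p] (TateModule A p) := by
  haveI : Fintype (A[(p : ℕ)]) := Fintype.ofFinite _
  -- a lift `s v ∈ T_p A` of each `v ∈ A[p]` in the image of the first projection (else `0`)
  let s : A[(p : ℕ)] → TateModule A p := fun v ↦
    if hv : ∃ b : TateModule A p, proj p 1 b = v then hv.choose else 0
  have hs : ∀ b : TateModule A p, proj p 1 (s ⟨proj p 1 b, proj_one_mem_torsionBy b⟩) = proj p 1 b :=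
    fun b ↦ by
      have hv : ∃ b' : TateModule A p, proj p 1 b' = proj p 1 b := ⟨b, rfl⟩
      simp only [s, dif_pos hv]
      exact hv.choose_spec
  let f : (A[(p : ℕ)] → ℤ_[p]) →ₗ[ℤ_[p]] TateModule A p := Fintype.linearCombination ℤ_[p] s
  haveI : IsAdicComplete (IsLocalRing.maximalIdeal ℤ_[p]) (A[(p : ℕ)] → ℤ_[p]) :=
    isAdicComplete_pi _ _
  -- `f` is surjective modulo `𝔪 T_p A`, hence surjective
  have hf : Function.Surjective
      ((IsLocalRing.maximalIdeal ℤ_[p] • ⊤ : Submodule ℤ_[p] (TateModule A p)).mkQ ∘ₗ f) := by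
    intro q
    obtain ⟨b, rfl⟩ := Submodule.mkQ_surjective _ q
    refine ⟨Pi.single ⟨proj p 1 b, proj_one_mem_torsionBy b⟩ 1, ?_⟩
    simp only [LinearMap.coe_comp, Function.comp_apply, f, Fintype.linearCombination_apply_single,
      one_smul, Submodule.mkQ_apply]
    rw [Submodule.Quotient.eq]
    exact mem_maximalIdeal_smul_top_of_proj_one_eq_zero (by rw [map_sub, hs b, sub_self])
  exact Module.Finite.of_surjective f (surjective_of_mkQ_comp_surjective hf)

/-- **Freeness of the Tate module.** If the `p`-torsion `A[p]` of an abelian group `A` is finite,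
then `T_p A` is a free `ℤ_[p]`-module (of finite rank): it is finitely generated
(`finite_of_finite_torsionBy`) and torsion-free over the principal ideal domain `ℤ_[p]`.
Silverman, *AEC*, Prop. III.7.1 (proof). [cite: SilvermanAEC2009, Prop. III.7.1 (proof)] -/
theorem free_of_finite_torsionBy (hA : Finite (A[(p : ℕ)])) :
    Module.Free ℤ_[p] (TateModule A p) := by
  haveI := finite_of_finite_torsionBy hA
  infer_instance

end TateModule

end Literature.NumberTheory.EllipticCurves

/-! ## The Tate module of an elliptic curve: reduction of III.7.1 to III.6.4 -/

namespace WeierstrassCurve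

open Literature.NumberTheory.EllipticCurves

variable {F : Type u} [Field F] (W : WeierstrassCurve F) (p : ℕ) [Fact p.Prime]

/-- Finiteness of the geometric `p`-torsion `E(F̄)[p]` (an instance of the named fact
`finite_torsionPoints`, Silverman III.6.4) implies that `T_p E` is a finitely generated
`ℤ_[p]`-module (the named fact `module_finite_tateModule`, Silverman III.7.1).
[cite: SilvermanAEC2009, Prop. III.7.1 with Cor. III.6.4] -/
theorem module_finite_tateModule_of_finite_torsionPoints
    (h : finite_torsionPoints W (AlgebraicClosure F)) : module_finite_tateModule W p := by
  intro _
  have hp : ((p : ℕ) : ℤ) ≠ 0 := by exact_mod_cast (Fact.out : p.Prime).ne_zero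
  have hfin : Finite ((geomPoints W)[(p : ℕ)]) := h hp
  exact TateModule.finite_of_finite_torsionBy hfin

/-- Finiteness of the geometric `p`-torsion `E(F̄)[p]` (an instance of the named fact
`finite_torsionPoints`, Silverman III.6.4) implies that `T_p E` is a free `ℤ_[p]`-module
(the named fact `module_free_tateModule`, Silverman III.7.1: `T_ℓ E ≅ ℤ_ℓ²` for `ℓ ≠ char F`,
`T_p E ≅ 0` or `ℤ_p` for `p = char F` — free in every case).
[cite: SilvermanAEC2009, Prop. III.7.1(a),(b) with Cor. III.6.4] -/
theorem module_free_tateModule_of_finite_torsionPoints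
    (h : finite_torsionPoints W (AlgebraicClosure F)) : module_free_tateModule W p := by
  intro _
  have hp : ((p : ℕ) : ℤ) ≠ 0 := by exact_mod_cast (Fact.out : p.Prime).ne_zero
  have hfin : Finite ((geomPoints W)[(p : ℕ)]) := h hp
  exact TateModule.free_of_finite_torsionBy hfin

end WeierstrassCurve
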